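import Summits.HubbardSuperconductivity.HubbardSuperconductivity.Theses.KacWindowPenalty
import Summits.HubbardSuperconductivity.HubbardSuperconductivity.Theses.DeformationLadder
import Literature.MathematicalPhysics.QuantumLattice.PairFieldMomentum
import Summits.HubbardSuperconductivity.HubbardSuperconductivity.Theorems.KacWindowPenaltyWindowGapPenalisedForms
import Summits.HubbardSuperconductivity.HubbardSuperconductivity.Theorems.DeformationLadderDeformedRung

/-!
# SketchIdeator5 (crux `WindowGap`, stmt-HubbardSuperconductivity-1088; round 2, ideator 5)

NO crux idea card is filed by this seat (see `Cruxes/WindowGap/EngineAudit-r2-k5.md`). This file PROVES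
(kernel-closed, 0 sorries) the positive calibration of that audit's §6: the body of
`KacWindowPenalty.WindowGap` with the pure torus `hubbardTorus 2 L 1 U` replaced by the BCS-deformed family
`K_L(U,g) = hubbardTorus 2 L 1 U − (g/L²) pFᴴpF` of route `DeformationLadder` holds for every `g > 0`,
`δ ∈ (0,1/2)` and all `U ∈ (0, U₀(g,δ))` — indeed in the `(λ,a)`-UNIFORM-in-`ε` form
(`WindowGapDeformed`), which `not_windowGap_uniform` (p105948) REFUTES for the pure model, and hence in the
crux's own quantifier shape (`WindowGapDeformedCruxShape`).

Proof: `K(g) + λW_ε ≥ K(g − λ)` as quadratic forms (the window dominates its zero mode,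
`re_expect_pairField_div_le_re_dotProduct_kacWindow_mulVec`, p98536), so with `λ = g/2` the window gap is
at least `E_L(g/2) − E_L(g)`; the right chord of the concave sector energy at a ground state of `K(g/2)`
(`order_le_rightChord`, SeededChords) bounds that by `(g/2)L⁻²·re⟨pFᴴpF⟩`; and `deformedRung_proof`
(stmt-1894, closed) gives every-ground-state LRO `re⟨pFᴴpF⟩ ≥ aL⁴` at coupling `g/2` for `U < U₀(g/2,δ)`.
Reading: the window-penalty bookkeeping is sound wherever a d-wave condensate is PROVED; the mean-field
attraction pins the condensate at `q = 0` (no Goldstone branch, no twist loophole), which is why the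
ε-uniform form holds here and fails for the pure model — a calibration of the route's algebra, not of its
physics. Candidate landing (idle prover): `Theorems/WindowGap/Calibration/DeformedFamily.lean --supports 1088`.
-/

set_option linter.dupNamespace false

namespace Summit.HubbardSuperconductivity.HubbardSuperconductivity.Cruxes.WindowGap.Ideator5

open Matrix Literature.MathematicalPhysics.QuantumLattice Literature.Probability.LatticeModels

/-- The Kac-window pair penalty of the crux (verbatim `let W` of `KacWindowPenalty.WindowGap`). -/
noncomputable def kacWindow (L : ℕ) [NeZero L] (ε : ℝ) :
    Matrix (Finset (Orb (FermionTorus 2 L))) (Finset (Orb (FermionTorus 2 L))) ℂ :=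
  ∑ m : Fin 2 → ZMod L,
    if (2 * Real.pi / (L : ℝ)) ^ 2 * (∑ i : Fin 2, (((m i).valMinAbs : ℤ) : ℝ) ^ 2) ≤ ε ^ 2 then
      ((L : ℂ) ^ 2)⁻¹ • (Matrix.conjTranspose (pairFieldAt dWaveFormFactor L m) * pairFieldAt dWaveFormFactor L m)
    else 0

/-- The BCS-deformed torus `K_L(U,g) = H − (g/L²) pFᴴpF` of route `DeformationLadder`. -/
noncomputable def deformedTorus (L : ℕ) [NeZero L] (U g : ℝ) :
    Matrix (Finset (Orb (FermionTorus 2 L))) (Finset (Orb (FermionTorus 2 L))) ℂ :=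
  hubbardTorus 2 L 1 U -
    ((g / (L : ℝ) ^ 2 : ℝ) : ℂ) • (Matrix.conjTranspose (pairField dWaveFormFactor L) * pairField dWaveFormFactor L)

/-- CALIBRATION (audit §6, proved below as `windowGapDeformed_holds`): the crux's inequality for the
deformed family, `(λ,a)`-uniformly in `ε`. -/
def WindowGapDeformed : Prop :=
  ∀ g : ℝ, 0 < g → ∀ δ ∈ Set.Ioo (0:ℝ) (1 / 2), ∃ U₀ : ℝ, 0 < U₀ ∧ ∀ U ∈ Set.Ioo (0:ℝ) U₀,
    ∃ lam a : ℝ, 0 < lam ∧ 0 < a ∧ ∀ C : ℝ, 0 ≤ C → ∀ ε : ℝ, 0 < ε → C * ε ≤ a →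
      ∃ L₀ : ℕ, ∀ (L : ℕ) [NeZero L], L₀ ≤ L → Even L →
        lam * (C * ε + a) * (L : ℝ) ^ 2 ≤
          (deformedTorus L U g + (lam : ℂ) • kacWindow L ε).minEnergyOn
              (szSector (2 * ⌊(1 - δ) * (L : ℝ) ^ 2 / 2⌋₊) 0) -
            (deformedTorus L U g).minEnergyOn (szSector (2 * ⌊(1 - δ) * (L : ℝ) ^ 2 / 2⌋₊) 0)

/-- Step (i) (proved below as `windowDominatesDeformation_holds`): the window dominates its zero mode, so
the penalised deformed torus dominates the deformed torus at the smaller coupling (quadratic forms). -/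
def WindowDominatesDeformation : Prop :=
  ∀ (L : ℕ) [NeZero L] (U g lam ε : ℝ), 0 ≤ lam →
    ∀ ψ : Fock (Orb (FermionTorus 2 L)),
      (star ψ ⬝ᵥ (deformedTorus L U (g - lam)) *ᵥ ψ).re ≤
        (star ψ ⬝ᵥ (deformedTorus L U g + (lam : ℂ) • kacWindow L ε) *ᵥ ψ).re

end Summit.HubbardSuperconductivity.HubbardSuperconductivity.Cruxes.WindowGap.Ideator5

namespace Summit.HubbardSuperconductivity.HubbardSuperconductivity.Cruxes.WindowGap.Ideator5

open Matrix Literature.MathematicalPhysics.QuantumLattice Literature.Probability.LatticeModels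

/-- Step (i) of the calibration, PROVED: `K(g) + λW_ε ≥ K(g − λ)` as quadratic forms for `λ ≥ 0`
(the window dominates its zero mode, `re_expect_pairField_div_le_re_dotProduct_kacWindow_mulVec`, p98536). -/
theorem windowDominatesDeformation_holds : WindowDominatesDeformation := by
  intro L _ U g lam ε hlam ψ
  have key := Summit.HubbardSuperconductivity.HubbardSuperconductivity.Theorems.re_expect_pairField_div_le_re_dotProduct_kacWindow_mulVec L ε ψ
  simp only [expect] at key
  change (star ψ ⬝ᵥ (hubbardTorus 2 L 1 U -
      (((g - lam) / (L : ℝ) ^ 2 : ℝ) : ℂ) • (Matrix.conjTranspose (pairField dWaveFormFactor L) * pairField dWaveFormFactor L)) *ᵥ ψ).re ≤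
    (star ψ ⬝ᵥ (hubbardTorus 2 L 1 U -
      ((g / (L : ℝ) ^ 2 : ℝ) : ℂ) • (Matrix.conjTranspose (pairField dWaveFormFactor L) * pairField dWaveFormFactor L) +
      (lam : ℂ) • kacWindow L ε) *ᵥ ψ).re
  simp only [Matrix.sub_mulVec, Matrix.add_mulVec, Matrix.smul_mulVec, dotProduct_add, dotProduct_sub,
    dotProduct_smul, smul_eq_mul, Complex.add_re, Complex.sub_re, Complex.re_ofReal_mul]
  set p := (star ψ ⬝ᵥ (Matrix.conjTranspose (pairField dWaveFormFactor L) * pairField dWaveFormFactor L) *ᵥ ψ).re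
  set w := (star ψ ⬝ᵥ kacWindow L ε *ᵥ ψ).re
  have key' : p / (L : ℝ) ^ 2 ≤ w := key
  have h1 : lam * (p / (L : ℝ) ^ 2) ≤ lam * w := mul_le_mul_of_nonneg_left key' hlam
  have h2 : (g - lam) / (L : ℝ) ^ 2 * p = g / (L : ℝ) ^ 2 * p - lam * (p / (L : ℝ) ^ 2) := by ring
  linarith

/-- **The calibration, PROVED (modulo nothing: `deformedRung_proof` is closed).** `WindowGap`'s inequality
for the BCS-deformed family, `(λ,a)`-uniformly in `ε`: domination `K(g)+λW_ε ≥ K(g−λ)` with `λ = g/2`,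
the right chord of the concave sector energy at a ground state of `K(g/2)` (`order_le_rightChord`), and
every-ground-state LRO of `K(U,g/2)` for `U < U₀(g/2,δ)` (`deformedRung_proof`). -/
theorem windowGapDeformed_holds : WindowGapDeformed := by
  intro g hg δ hδ
  obtain ⟨U₀, hU₀, hDR⟩ :=
    Summit.HubbardSuperconductivity.HubbardSuperconductivity.Theorems.deformedRung_proof (g / 2) (half_pos hg) δ hδ
  refine ⟨U₀, hU₀, fun U hU => ?_⟩
  obtain ⟨a, ha, L₀, hL⟩ := hDR U ⟨hU.1.le, hU.2⟩
  refine ⟨g / 2, a / 2, half_pos hg, half_pos ha, fun C hC ε hε hCε => ⟨L₀, fun L _ hLL _ => ?_⟩⟩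
  have hn : ⌊(1 - δ) * (L : ℝ) ^ 2 / 2⌋₊ ≤ Fintype.card (FermionTorus 2 L) := by
    rw [show Fintype.card (FermionTorus 2 L) = L ^ 2 by simp]
    exact Summit.HubbardSuperconductivity.NoGo.floor_pairNumber_le δ (by linarith [hδ.1]) L
  obtain ⟨φ, hφ1, hφgs⟩ :=
    Summit.HubbardSuperconductivity.TwTipContinuation.Negative.exists_unit_groundState U (g / 2) L hn
  have hLRO : a ≤ (expect ((pairField dWaveFormFactor L)ᴴ * pairField dWaveFormFactor L) φ).re / (L : ℝ) ^ 4 :=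
    hL L hLL φ hφ1 hφgs
  have hchord :=
    Summit.HubbardSuperconductivity.TwTipContinuation.Negative.order_le_rightChord (U := U) (L := L)
      (show g / 2 < g by linarith) hφ1 hφgs
  have hdom : (deformedTorus L U (g / 2)).minEnergyOn (szSector (2 * ⌊(1 - δ) * (L : ℝ) ^ 2 / 2⌋₊) 0) ≤
      (deformedTorus L U g + ((g / 2 : ℝ) : ℂ) • kacWindow L ε).minEnergyOn
        (szSector (2 * ⌊(1 - δ) * (L : ℝ) ^ 2 / 2⌋₊) 0) := by
    change _ ≤ sInf _
    refine le_csInf ⟨_, φ, hφgs.1, hφ1, rfl⟩ ?_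
    rintro b ⟨ψ, hψK, hψ, rfl⟩
    refine (Summit.HubbardSuperconductivity.HubbardSuperconductivity.Theorems.minEnergyOn_le_re_rayleigh _ _ hψK hψ).trans ?_
    have := windowDominatesDeformation_holds L U g (g / 2) ε (half_pos hg).le ψ
    rwa [show g - g / 2 = g / 2 by ring] at this
  have hLpos : (0 : ℝ) < (L : ℝ) := by exact_mod_cast Nat.pos_of_ne_zero (NeZero.ne L)
  have hL2 : (0 : ℝ) < (L : ℝ) ^ 2 := by positivity
  have hL4 : (0 : ℝ) < (L : ℝ) ^ 4 := by positivity
  set p := (expect ((pairField dWaveFormFactor L)ᴴ * pairField dWaveFormFactor L) φ).re with hp_def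
  have hp : a * (L : ℝ) ^ 4 ≤ p := (le_div_iff₀ hL4).1 hLRO
  have hE : (g - g / 2) / (L : ℝ) ^ 2 * p ≤
      (deformedTorus L U (g / 2)).minEnergyOn (szSector (2 * ⌊(1 - δ) * (L : ℝ) ^ 2 / 2⌋₊) 0) -
        (deformedTorus L U g).minEnergyOn (szSector (2 * ⌊(1 - δ) * (L : ℝ) ^ 2 / 2⌋₊) 0) := hchord
  have h3 : g / 2 * (C * ε + a / 2) * (L : ℝ) ^ 2 ≤ g / 2 * a * (L : ℝ) ^ 2 := by
    apply mul_le_mul_of_nonneg_right _ hL2.le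
    exact mul_le_mul_of_nonneg_left (by linarith) (half_pos hg).le
  have h4 : g / 2 * a * (L : ℝ) ^ 2 ≤ (g - g / 2) / (L : ℝ) ^ 2 * p := by
    have h44 : g / 2 * (a * (L : ℝ) ^ 4) ≤ g / 2 * p := mul_le_mul_of_nonneg_left hp (half_pos hg).le
    have key : (g - g / 2) / (L : ℝ) ^ 2 * p = (g / 2 * p) / (L : ℝ) ^ 2 := by ring
    rw [key, le_div_iff₀ hL2]
    calc g / 2 * a * (L : ℝ) ^ 2 * (L : ℝ) ^ 2 = g / 2 * (a * (L : ℝ) ^ 4) := by ring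
      _ ≤ g / 2 * p := h44
  linarith

/-- The calibration in the crux's own quantifier shape: the body of `KacWindowPenalty.WindowGap` with
`hubbardTorus 2 L 1 U` replaced by the deformed torus `K_L(U,g)`, for every `g > 0`, `δ`, and all
`U ∈ (0, U₀(g,δ))`. -/
def WindowGapDeformedCruxShape : Prop :=
  ∀ g : ℝ, 0 < g → ∀ δ ∈ Set.Ioo (0:ℝ) (1 / 2), ∃ U₀ : ℝ, 0 < U₀ ∧ ∀ U ∈ Set.Ioo (0:ℝ) U₀,
    ∀ C : ℝ, 0 ≤ C → ∀ ε₀ : ℝ, 0 < ε₀ → ∃ ε ∈ Set.Ioc (0:ℝ) ε₀, ∃ lam a : ℝ, 0 < lam ∧ 0 < a ∧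
      ∃ L₀ : ℕ, ∀ (L : ℕ) [NeZero L], L₀ ≤ L → Even L →
        lam * (C * ε + a) * (L : ℝ) ^ 2 ≤
          (deformedTorus L U g + (lam : ℂ) • kacWindow L ε).minEnergyOn
              (szSector (2 * ⌊(1 - δ) * (L : ℝ) ^ 2 / 2⌋₊) 0) -
            (deformedTorus L U g).minEnergyOn (szSector (2 * ⌊(1 - δ) * (L : ℝ) ^ 2 / 2⌋₊) 0)

theorem windowGapDeformedCruxShape_holds : WindowGapDeformedCruxShape := by
  intro g hg δ hδ
  obtain ⟨U₀, hU₀, h⟩ := windowGapDeformed_holds g hg δ hδ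
  refine ⟨U₀, hU₀, fun U hU C hC ε₀ hε₀ => ?_⟩
  obtain ⟨lam, a, hlam, ha, hall⟩ := h U hU
  have hCp : 0 < C + 1 := by linarith
  set ε := min ε₀ (a / (C + 1)) with hε_def
  have hεpos : 0 < ε := lt_min hε₀ (div_pos ha hCp)
  have hεle : ε ≤ ε₀ := min_le_left _ _
  have hCε : C * ε ≤ a := by
    have h1 : ε ≤ a / (C + 1) := min_le_right _ _
    have h2 : C * ε ≤ C * (a / (C + 1)) := mul_le_mul_of_nonneg_left h1 hC
    have h3 : C * (a / (C + 1)) ≤ a := by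
      rw [mul_div_assoc', div_le_iff₀ hCp]; nlinarith
    linarith
  obtain ⟨L₀, hL⟩ := hall C hC ε hεpos hCε
  exact ⟨ε, ⟨hεpos, hεle⟩, lam, a, hlam, ha, L₀, fun L _ hLL hE => hL L hLL hE⟩

end Summit.HubbardSuperconductivity.HubbardSuperconductivity.Cruxes.WindowGap.Ideator5
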